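import Summits.RiemannHypothesis.RiemannHypothesis.Theorems.SoloInformedSpectralCeiling
import Summits.RiemannHypothesis.RiemannHypothesis.Theorems.SoloInformedGroundStatePairing
import Summits.RiemannHypothesis.RiemannHypothesis.Theorems.SoloInformedOnset
import Summits.RiemannHypothesis.RiemannHypothesis.Theorems.SoloInformedNodeInterpolation
import Literature.Barriers.RiemannHypothesis.MollifierLimitationsHolds
import Literature.NumberTheory.LFunctions.WeilExplicitFormulaProofs
import Literature.NumberTheory.LFunctions.WeilMellinInversion
import Literature.NumberTheory.LFunctions.WeilGroundState
import Literature.NumberTheory.LFunctions.WeilGroundStateRealZerosProofs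
import HarnessLib

/-!
# RH iff the window forms never degenerate (solo-informed T62)

Write `ε(a) = weilGroundEnergy a` for the ground energy of Weil's form on the window `[-a, a]`
(the infimum of `Re Q(g)` over smooth `g` with `tsupport g ⊆ [-a, a]`, `‖g‖₂ = 1`). The tree has
`RH ↔ ∀ a > 0, ε(a) ≥ 0` (`riemannHypothesis_iff_forall_weilPositivityOn`) and, if RH fails, an
onset window with `ε(a₀) = 0` exactly (`exists_isWeilOnset_of_not_riemannHypothesis`, T56; this
is Yoshida's Prop. 6 in the variational normalisation). Here the converse half is proved:

* `weilGroundEnergy_pos_of_riemannHypothesis` — **under RH, `ε(a) > 0` for every `a > 0`**: the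
  window forms are uniformly positive definite on the `L²`-sphere, not merely semi-definite.
* `riemannHypothesis_iff_forall_weilGroundEnergy_pos`, and the SIGN-FREE reading
  `riemannHypothesis_iff_forall_weilGroundEnergy_ne_zero` — **RH iff no window form degenerates**
  (`ε(a) ≠ 0` for all `a > 0`): Yoshida 1992, Thm. 2 ("RH holds iff the hermitian form on `K̂(a)`
  is non-degenerate for every `a > 0`"), in the variational form `inf ≠ 0`, without completions.

Proof of the first item (no limit object; Yoshida takes a null vector of the completed form and
runs Jensen's formula against Siegel's `N(r) ≠ O(r)` for distinct zeros). Suppose RH and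
`ε(a) ≤ 0`; take a normalised test `g` on `[-a, a]` with `Re Q(g) < δ²` (minimising sequence).
1. SPECTRAL CEILING (T41, `weilQuadratic_re_ge_ceiling`): `Re Q(g) ≤ 1` forces `|ĝ(½+it₀)|² > c`
   for some `|t₀| < H`, with `H, c > 0` depending only on `a` (`exists_large_value_on_segment`).
2. ZERO SIDE UNDER RH (`explicit_formula_holds`): `Σ_{γ ∈ S} |ĝ(½+iγ)|² ≤ Re Q(g) < δ²` for every
   finite set `S` of ordinates of zeros (`sum_norm_sq_weilMellin_le_re_weilQuadratic`).
3. SELBERG'S NODES (`Radziwill2012_lemma5_holds`, a theorem of the tree): `≥ c₀ T log T` ordinates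
   of zeros ON the critical line in `[T, 2T]`, pairwise `≥ 2πA/log T` apart.
4. INTERPOLATION (T62a `norm_le_of_small_on_separated_nodes`; `ĝ` is entire with
   `|ĝ(s)| ≤ e^{a|Re s − ½|} √(2a)`): with `N = #S ≥ c₀ T log T`,
   `|ĝ(½+it₀)| ≤ e^{3a(2T+H)} √(2a)/2^N + 2Nδ(4(2T+H)log T/(2πA))^{N−1}`; choosing `T` (first
   term `≤ √c/2`, as `T log T` beats `T`) and then `δ` kills `|ĝ(½+it₀)| > √c`.

References: H. Yoshida, Adv. Stud. Pure Math. 21 (1992) 281–325, Prop. 6, Thm. 2 (key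
`Yoshida1992`); E. Bombieri, Rend. Mat. Acc. Lincei (9) 11 (2000) §4 (key `Bombieri2000Weil`);
M. Radziwiłł, arXiv:1207.6583 (2012) Lemma 5, after A. Selberg (1942) (key `Radziwill2012`).
-/

noncomputable section

open Complex Filter Set Topology Metric MeasureTheory
open Literature.NumberTheory.LFunctions Literature.Barriers.RiemannHypothesis
open Literature.Analysis.SpecialFunctions
open scoped Real

namespace Summit.RiemannHypothesis.RiemannHypothesis.Theorems

/-! ## The zero side under RH, sampled at finitely many critical zeros -/

/-- Under RH, for a test `g` and a finite set `S` of non-zero ordinates `γ` with `ζ(½ + iγ) = 0`,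
`Σ_{γ ∈ S} |ĝ(½ + iγ)|² ≤ Re Q(g)` (explicit formula; every truncated zero side beyond the height
of `S` dominates the sub-sum, the multiplicities being `≥ 1`). [cite: Bombieri2000Weil, §3 (3.2)] -/
theorem sum_norm_sq_weilMellin_le_re_weilQuadratic (hRH : RiemannHypothesis) {g : ℝ → ℂ}
    (hg : IsWeilTest g) (S : Finset ℝ) (hS0 : ∀ γ ∈ S, γ ≠ 0)
    (hS : ∀ γ ∈ S, riemannZeta (1 / 2 + γ * I) = 0) :
    ∑ γ ∈ S, ‖weilMellin g (1 / 2 + γ * I)‖ ^ 2 ≤ (weilQuadratic g).re := by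
  classical
  set k : ℝ → ℂ := weilConv g (weilReflect g) with hk
  have hkt : IsWeilTest k := hg.weilConv hg.weilReflect
  have hlim : Tendsto (fun T ↦ (weilZeroSidePartial k T).re) atTop (𝓝 (weilQuadratic g).re) :=
    (Complex.continuous_re.tendsto _).comp (explicit_formula_holds hkt)
  refine ge_of_tendsto hlim ?_
  rw [Filter.eventually_atTop]
  refine ⟨∑ γ ∈ S, |γ|, fun T hT ↦ ?_⟩
  set ρ : ℝ → ℂ := fun γ ↦ 1 / 2 + γ * I with hρ
  have hρinj : Function.Injective ρ := by
    intro x y h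
    have h' := congrArg Complex.im h
    simpa [hρ] using h'
  have hfin := weilZeroIndex_finite T
  have hsub : S.image ρ ⊆ hfin.toFinset := by
    intro z hz
    obtain ⟨γ, hγ, rfl⟩ := Finset.mem_image.1 hz
    rw [Set.Finite.mem_toFinset]
    have hγT : |γ| ≤ T :=
      (Finset.single_le_sum (fun x _ ↦ abs_nonneg x) hγ).trans hT
    refine ⟨hS γ hγ, ?_, ?_, ?_, ?_⟩
    · simp [hρ]
    · norm_num [hρ]
    · simpa [hρ] using hS0 γ hγ
    · simpa [hρ] using hγT
  have hre : ∀ z ∈ hfin.toFinset, ((riemannZetaZeroOrder z : ℂ) * weilMellin k z).re =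
      (riemannZetaZeroOrder z : ℝ) * ‖weilMellin g z‖ ^ 2 ∧ riemannZeta z = 0 ∧ z ≠ 1 := by
    intro z hz
    rw [Set.Finite.mem_toFinset] at hz
    obtain ⟨hζ, -, -, him, -⟩ := hz
    have hne : z ≠ 1 := by
      rintro rfl
      simp at him
    have hzre : z.re = 1 / 2 := by
      refine hRH z hζ ?_ hne
      rintro ⟨n, rfl⟩
      simp at him
    refine ⟨?_, hζ, hne⟩
    rw [hk, weilMellin_weilQuadratic_of_re_eq hg hzre, ← Complex.ofReal_intCast,
      ← Complex.ofReal_mul, Complex.ofReal_re, Complex.normSq_eq_norm_sq]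
  have hpart : (weilZeroSidePartial k T).re =
      ∑ z ∈ hfin.toFinset, (riemannZetaZeroOrder z : ℝ) * ‖weilMellin g z‖ ^ 2 := by
    unfold weilZeroSidePartial
    rw [finsum_mem_eq_finite_toFinset_sum _ hfin, Complex.re_sum]
    exact Finset.sum_congr rfl fun z hz ↦ (hre z hz).1
  rw [hpart]
  calc ∑ γ ∈ S, ‖weilMellin g (1 / 2 + γ * I)‖ ^ 2
      = ∑ z ∈ S.image ρ, ‖weilMellin g z‖ ^ 2 := by
        rw [Finset.sum_image fun x _ y _ h ↦ hρinj h]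
    _ ≤ ∑ z ∈ S.image ρ, (riemannZetaZeroOrder z : ℝ) * ‖weilMellin g z‖ ^ 2 := by
        refine Finset.sum_le_sum fun z hz ↦ ?_
        obtain ⟨-, hζ, hne⟩ := hre z (hsub hz)
        have h0 := Int.add_one_le_iff.2 ((riemannZetaZeroOrder_pos_iff hne).2 hζ)
        rw [zero_add] at h0
        have h1 : (1 : ℝ) ≤ riemannZetaZeroOrder z := by exact_mod_cast h0
        nlinarith [sq_nonneg ‖weilMellin g z‖]
    _ ≤ ∑ z ∈ hfin.toFinset, (riemannZetaZeroOrder z : ℝ) * ‖weilMellin g z‖ ^ 2 :=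
        Finset.sum_le_sum_of_subset_of_nonneg hsub fun z hz _ ↦ by
          obtain ⟨-, -, hne⟩ := hre z hz
          exact mul_nonneg (by exact_mod_cast riemannZetaZeroOrder_nonneg hne) (sq_nonneg _)

/-! ## Step 1: a large value on a bounded critical segment -/

/-- **Spectral ceiling, pointwise.** For every window `a > 0` there are `H > 0` and `c > 0` such
that every normalised test `g` on `[-a, a]` with `Re Q(g) ≤ 1` has `|ĝ(½ + it₀)|² > c` at some
`|t₀| < H` (T41 `weilQuadratic_re_ge_ceiling` with `Re ψ(¼ + iH/2) ≥ L(a) + 2`, and the mean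
value on `(-H, H)`). [cite: Bombieri2000Weil, §4 Lemma 3 and (4.3)] -/
theorem exists_large_value_on_segment (a : ℝ) :
    ∃ H c : ℝ, 0 < H ∧ 0 < c ∧ ∀ g : ℝ → ℂ, IsWeilTest g → tsupport g ⊆ Icc (-a) a →
      ∫ t, ‖g t‖ ^ 2 = (1 : ℝ) → (weilQuadratic g).re ≤ 1 →
        ∃ t₀ : ℝ, |t₀| < H ∧ c < ‖weilMellin g (1 / 2 + t₀ * I)‖ ^ 2 := by
  obtain ⟨C, hC⟩ := exists_log_sub_le_reDigammaQuarter
  obtain ⟨H, hH0, hWL⟩ : ∃ H : ℝ, 0 < H ∧ ceilingConst a + 2 ≤ reDigammaQuarter H := by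
    set E : ℝ := Real.exp (ceilingConst a + 2 + C) with hE
    have hE0 : 0 < E := Real.exp_pos _
    refine ⟨2 * E, by positivity, ?_⟩
    have h1 := hC (2 * E)
    have h2 : ceilingConst a + 2 + C ≤ Real.log (1 + |2 * E| / 2) := by
      rw [abs_of_pos (by positivity), Real.le_log_iff_exp_le (by positivity)]
      have : 2 * E / 2 = E := by ring
      rw [this, ← hE]
      linarith
    linarith
  have hw₀W : reDigammaQuarter 0 ≤ reDigammaQuarter H := reDigammaQuarter_zero_le H
  have hden : 0 < reDigammaQuarter H - reDigammaQuarter 0 + 1 := by linarith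
  refine ⟨H, π / (2 * H * (reDigammaQuarter H - reDigammaQuarter 0 + 1)), hH0, by positivity,
    fun g hg hsupp hnorm hQ ↦ ?_⟩
  have hceil := weilQuadratic_re_ge_ceiling hg hsupp H
  rw [hnorm, mul_one, abs_of_pos hH0] at hceil
  set W : ℝ := reDigammaQuarter H with hW
  set w₀ : ℝ := reDigammaQuarter 0 with hw₀
  set m : ℝ := ∫ t in Ioo (-H) H, ‖weilMellin g (1 / 2 + t * I)‖ ^ 2 with hm
  have hπ : (0 : ℝ) < 2 * π := by positivity
  -- mass below height `H`
  have h1 : 1 ≤ (W - w₀) * (1 / (2 * π) * m) := by linarith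
  have hm_ge : 2 * π ≤ (W - w₀) * m := by
    have e : (W - w₀) * (1 / (2 * π) * m) = (W - w₀) * m / (2 * π) := by ring
    rw [e, le_div_iff₀ hπ, one_mul] at h1
    exact h1
  have hm0 : 0 ≤ m := setIntegral_nonneg measurableSet_Ioo fun t _ ↦ by positivity
  have hm_pos : 2 * π / (W - w₀ + 1) ≤ m := by
    rw [div_le_iff₀ hden]
    nlinarith
  -- mean value on `(-H, H)`
  by_contra hcon
  push Not at hcon
  have hfi : IntegrableOn (fun t : ℝ ↦ ‖weilMellin g (1 / 2 + t * I)‖ ^ 2) (Ioo (-H) H) :=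
    (integrable_norm_sq_weilMellin_half_line hg).integrableOn
  have hle : m ≤ ∫ _t in Ioo (-H) H, π / (2 * H * (W - w₀ + 1)) := by
    refine setIntegral_mono_on hfi (integrableOn_const (by simp [Real.volume_Ioo]))
      measurableSet_Ioo fun t ht ↦ ?_
    exact hcon t (abs_lt.2 ⟨ht.1, ht.2⟩)
  have hconst : ∫ _t in Ioo (-H) H, π / (2 * H * (W - w₀ + 1)) = π / (W - w₀ + 1) := by
    rw [setIntegral_const, Real.volume_real_Ioo_of_le (by linarith), smul_eq_mul]
    field_simp
    ring
  rw [hconst] at hle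
  have hlt : π / (W - w₀ + 1) < 2 * π / (W - w₀ + 1) := by
    rw [div_lt_div_iff_of_pos_right hden]
    linarith [Real.pi_pos]
  linarith

/-! ## Steps 2–4: small values at Selberg's nodes -/

/-- **The node bound.** Under RH, a normalised test `g` on `[-a, a]` with `Re Q(g) < δ²` has, for
every `|t₀| < H` and every finite set `S` of ordinates of critical zeros in `[T, 2T]`, `T ≥ 1`,
pairwise `≥ 2πA/log T` apart,
`|ĝ(½ + it₀)| ≤ e^{3a(2T+H)} √(2a) / 2^{#S} + 2 #S δ (4(2T+H)/(2πA/log T))^{#S−1}`. [new] -/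
theorem norm_weilMellin_le_of_nodes (hRH : RiemannHypothesis) {g : ℝ → ℂ} (hg : IsWeilTest g)
    {a : ℝ} (ha : 0 < a) (hsupp : tsupport g ⊆ Icc (-a) a) (hnorm : ∫ t, ‖g t‖ ^ 2 = (1 : ℝ))
    {T H A t₀ δ : ℝ} (hT : 1 ≤ T) (hlogT : 0 < Real.log T) (hA : 0 < A) (hH : 0 < H)
    (ht₀ : |t₀| < H) (hδ : 0 < δ) (S : Finset ℝ)
    (hS : ∀ γ ∈ S, γ ∈ Icc T (2 * T) ∧ riemannZeta (1 / 2 + γ * I) = 0)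
    (hsep : ∀ γ ∈ S, ∀ γ' ∈ S, γ ≠ γ' → 2 * π * A / Real.log T ≤ |γ - γ'|)
    (hQ : (weilQuadratic g).re < δ ^ 2) :
    ‖weilMellin g (1 / 2 + t₀ * I)‖ ≤
      Real.exp (3 * (2 * T + H) * a) * Real.sqrt (2 * a) / 2 ^ S.card +
        2 * S.card * δ * (4 * (2 * T + H) / (2 * π * A / Real.log T)) ^ (S.card - 1) := by
  classical
  set ρ : ℝ → ℂ := fun γ ↦ 1 / 2 + γ * I with hρ
  have hρsub : ∀ x y : ℝ, ρ x - ρ y = ((x - y : ℝ) : ℂ) * I := fun x y ↦ by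
    simp only [hρ]; push_cast; ring
  have hρnorm : ∀ x y : ℝ, ‖ρ x - ρ y‖ = |x - y| := fun x y ↦ by
    rw [hρsub, norm_mul, Complex.norm_I, mul_one, Complex.norm_real, Real.norm_eq_abs]
  have hρinj : Function.Injective ρ := fun x y h ↦ by
    have h' : ‖ρ x - ρ y‖ = 0 := by rw [h, sub_self, norm_zero]
    rw [hρnorm] at h'
    exact eq_of_abs_sub_eq_zero h'
  set Z : Finset ℂ := S.image ρ with hZ
  have hZcard : Z.card = S.card := Finset.card_image_of_injective S hρinj
  set s₀ : ℂ := ρ t₀ with hs₀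
  set r : ℝ := 2 * T + H with hr
  have hr0 : 0 < r := by positivity
  set d : ℝ := 2 * π * A / Real.log T with hd
  have hd0 : 0 < d := by positivity
  -- the four hypotheses of the interpolation lemma
  have hZr : ∀ z ∈ Z, ‖z - s₀‖ ≤ r := by
    intro z hz
    obtain ⟨γ, hγ, rfl⟩ := Finset.mem_image.1 hz
    rw [hs₀, hρnorm]
    have h1 := (hS γ hγ).1
    have : |γ - t₀| ≤ |γ| + |t₀| := abs_sub _ _
    have hγabs : |γ| ≤ 2 * T := by
      rw [abs_of_nonneg (by linarith [h1.1])]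
      exact h1.2
    linarith [ht₀.le]
  have hZsep : ∀ z ∈ Z, ∀ w ∈ Z, z ≠ w → d ≤ ‖z - w‖ := by
    intro z hz w hw hzw
    obtain ⟨γ, hγ, rfl⟩ := Finset.mem_image.1 hz
    obtain ⟨γ', hγ', rfl⟩ := Finset.mem_image.1 hw
    rw [hρnorm]
    exact hsep γ hγ γ' hγ' fun h ↦ hzw (h ▸ rfl)
  have hS0 : ∀ γ ∈ S, γ ≠ 0 := fun γ hγ ↦ by
    have := (hS γ hγ).1.1
    exact ne_of_gt (by linarith)
  have hsum := sum_norm_sq_weilMellin_le_re_weilQuadratic hRH hg S hS0 fun γ hγ ↦ (hS γ hγ).2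
  have hZδ : ∀ z ∈ Z, ‖weilMellin g z‖ ≤ δ := by
    intro z hz
    obtain ⟨γ, hγ, rfl⟩ := Finset.mem_image.1 hz
    have h1 : ‖weilMellin g (1 / 2 + γ * I)‖ ^ 2 ≤
        ∑ x ∈ S, ‖weilMellin g (1 / 2 + x * I)‖ ^ 2 :=
      Finset.single_le_sum (f := fun x : ℝ ↦ ‖weilMellin g (1 / 2 + x * I)‖ ^ 2)
        (fun x _ ↦ sq_nonneg _) hγ
    have h2 : ‖weilMellin g (1 / 2 + γ * I)‖ ^ 2 < δ ^ 2 := by linarith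
    exact (lt_of_pow_lt_pow_left₀ 2 hδ.le h2).le
  have hM : ∀ s : ℂ, ‖s - s₀‖ = 3 * r →
      ‖weilMellin g s‖ ≤ Real.exp (3 * (2 * T + H) * a) * Real.sqrt (2 * a) := by
    intro s hs
    have h1 := norm_weilMellin_le_window hg hsupp ha.le s
    rw [hnorm, Real.sqrt_one, mul_one] at h1
    refine h1.trans (mul_le_mul_of_nonneg_right ?_ (Real.sqrt_nonneg _))
    rw [Real.exp_le_exp]
    have h2 : |s.re - 1 / 2| ≤ 3 * r := by
      have e : s.re - 1 / 2 = (s - s₀).re := by simp [hs₀, hρ]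
      rw [e]
      exact (Complex.abs_re_le_norm _).trans hs.le
    nlinarith
  have key := norm_le_of_small_on_separated_nodes
    (differentiable_weilMellin hg.1.continuous hg.2) s₀ Z hr0 hd0 hδ.le hZr hZsep hZδ hM
  rw [hZcard] at key
  exact key

/-- **Choice of the height.** `T log T` beats `T`: for all large `T`,
`e^{3a(2T+H)} √(2a) / 2^{N} ≤ √c / 2` whenever `N ≥ c₀ T log T`. [folklore] -/
theorem exists_height_for_window {a c c₀ : ℝ} (H : ℝ) (ha : 0 < a) (hc : 0 < c)
    (hc₀ : 0 < c₀) (T₀ : ℝ) :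
    ∃ T : ℝ, T₀ ≤ T ∧ Real.exp 1 ≤ T ∧ ∀ N : ℕ, c₀ * T * Real.log T ≤ N →
      Real.exp (3 * (2 * T + H) * a) * Real.sqrt (2 * a) / 2 ^ N ≤ Real.sqrt c / 2 := by
  set K : ℝ := (6 * a + 1) / (c₀ * Real.log 2) with hK
  set B : ℝ := 3 * H * a + |Real.log (Real.sqrt (2 * a))| + |Real.log (Real.sqrt c / 2)|
    with hB
  set T : ℝ := max (max T₀ (Real.exp 1)) (max (Real.exp K) B) with hT
  have hT0 : T₀ ≤ T := le_trans (le_max_left _ _) (le_max_left _ _)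
  have hTe : Real.exp 1 ≤ T := le_trans (le_max_right _ _) (le_max_left _ _)
  have hTK : Real.exp K ≤ T := le_trans (le_max_left _ _) (le_max_right _ _)
  have hTB : B ≤ T := le_trans (le_max_right _ _) (le_max_right _ _)
  have hTpos : 0 < T := lt_of_lt_of_le (Real.exp_pos 1) hTe
  have hlog2 : 0 < Real.log 2 := Real.log_pos one_lt_two
  have hKlog : K ≤ Real.log T := by
    rw [Real.le_log_iff_exp_le hTpos]; exact hTK
  refine ⟨T, hT0, hTe, fun N hN ↦ ?_⟩
  have h2N : (0 : ℝ) < 2 ^ N := by positivity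
  rw [div_le_iff₀ h2N]
  -- compare logarithms
  have hNlog : (6 * a + 1) * T ≤ N * Real.log 2 := by
    have h1 : c₀ * T * K ≤ c₀ * T * Real.log T :=
      mul_le_mul_of_nonneg_left hKlog (by positivity)
    have e : c₀ * T * K * Real.log 2 = (6 * a + 1) * T := by
      rw [hK]; field_simp
    nlinarith
  have hlhs : Real.exp (3 * (2 * T + H) * a) * Real.sqrt (2 * a) =
      Real.exp (3 * (2 * T + H) * a + Real.log (Real.sqrt (2 * a))) := by
    rw [Real.exp_add, Real.exp_log (Real.sqrt_pos.2 (by positivity))]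
  have hrhs : Real.sqrt c / 2 * 2 ^ N =
      Real.exp (Real.log (Real.sqrt c / 2) + N * Real.log 2) := by
    rw [Real.exp_add, Real.exp_log (by positivity), Real.exp_nat_mul, Real.exp_log two_pos]
  rw [hlhs, hrhs, Real.exp_le_exp]
  have h3 := le_abs_self (Real.log (Real.sqrt (2 * a)))
  have h4 := neg_abs_le (Real.log (Real.sqrt c / 2))
  nlinarith

/-! ## The theorems -/

/-- **Under RH every window form is uniformly positive definite:** `0 < ε(a)` for all `a > 0`.
(Yoshida 1992 Thm. 2 gives non-degeneracy of the completed form under RH; here the variational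
statement, by Steps 1–4 of the module docstring.) [cite: Yoshida1992, Thm. 2] -/
theorem weilGroundEnergy_pos_of_riemannHypothesis (hRH : RiemannHypothesis) {a : ℝ} (ha : 0 < a) :
    0 < weilGroundEnergy a := by
  classical
  by_contra hpos
  push Not at hpos
  obtain ⟨H, c, hH, hc, hseg⟩ := exists_large_value_on_segment a
  obtain ⟨A, hA, c₀, hc₀, T₀, hnodes⟩ := Radziwill2012_lemma5_holds
  obtain ⟨T, hT0, hTe, hgrowth⟩ := exists_height_for_window H ha hc hc₀ T₀
  have hT1 : 1 ≤ T := le_trans (by have := Real.add_one_le_exp (1 : ℝ); linarith) hTe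
  have hTpos : 0 < T := by linarith
  have hlogT : 0 < Real.log T := by
    have : 1 ≤ Real.log T := by rw [Real.le_log_iff_exp_le hTpos]; exact hTe
    linarith
  obtain ⟨S, hS, hsep, hcard⟩ := hnodes T hT0
  set N : ℕ := S.card with hN
  set X : ℝ := (4 * (2 * T + H) / (2 * π * A / Real.log T)) ^ (N - 1) with hX
  have hX0 : 0 < X := by positivity
  -- choice of `δ`, then of the near-minimiser `g`
  set δ : ℝ := Real.sqrt c / (2 * (2 * N * X + 1)) with hδ
  have hδ0 : 0 < δ := by positivity
  have hδX : 2 * N * δ * X ≤ Real.sqrt c / 2 := by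
    have hden : 0 < 2 * N * X + 1 := by positivity
    have e : 2 * N * δ * X = Real.sqrt c / 2 * (2 * N * X / (2 * N * X + 1)) := by
      rw [hδ]; field_simp
    rw [e]
    have h1 : 2 * N * X / (2 * N * X + 1) ≤ 1 := by
      rw [div_le_one hden]; linarith
    have h2 : 0 ≤ Real.sqrt c / 2 := by positivity
    nlinarith
  obtain ⟨g, hgall, hlim⟩ := exists_weilMinimizingSeq ha
  have hev : ∀ᶠ n in atTop, (weilQuadratic (g n)).re < min (δ ^ 2) 1 :=
    hlim.eventually (gt_mem_nhds (lt_min_iff.2 ⟨by nlinarith, by linarith⟩))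
  obtain ⟨n, hn⟩ := hev.exists
  obtain ⟨hgt, hgs, hgn⟩ := hgall n
  have hQδ : (weilQuadratic (g n)).re < δ ^ 2 := lt_of_lt_of_le hn (min_le_left _ _)
  have hQ1 : (weilQuadratic (g n)).re ≤ 1 := (lt_of_lt_of_le hn (min_le_right _ _)).le
  -- Step 1: a large value
  obtain ⟨t₀, ht₀, hbig⟩ := hseg (g n) hgt hgs hgn hQ1
  -- Steps 2–4: the node bound
  have hnode := norm_weilMellin_le_of_nodes hRH hgt ha hgs hgn hT1 hlogT hA hH ht₀ hδ0 S hS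
    hsep hQδ
  have hfirst := hgrowth N hcard
  have hle : ‖weilMellin (g n) (1 / 2 + t₀ * I)‖ ≤ Real.sqrt c := by
    have h2 : ‖weilMellin (g n) (1 / 2 + t₀ * I)‖ ≤ Real.sqrt c / 2 + Real.sqrt c / 2 :=
      hnode.trans (add_le_add hfirst hδX)
    linarith
  have hlt : Real.sqrt c < ‖weilMellin (g n) (1 / 2 + t₀ * I)‖ := by
    have := Real.sqrt_lt_sqrt hc.le hbig
    rwa [Real.sqrt_sq (norm_nonneg _)] at this
  linarith

/-- **RH iff every window form is uniformly positive definite**: `RH ↔ ∀ a > 0, 0 < ε(a)`.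
[cite: Yoshida1992, Thm. 2] -/
theorem riemannHypothesis_iff_forall_weilGroundEnergy_pos :
    RiemannHypothesis ↔ ∀ a : ℝ, 0 < a → 0 < weilGroundEnergy a := by
  refine ⟨fun hRH a ha ↦ weilGroundEnergy_pos_of_riemannHypothesis hRH ha, fun h ↦ ?_⟩
  exact riemannHypothesis_iff_forall_weilPositivityOn.2
    fun a ha ↦ (weilGroundEnergy_nonneg_iff_holds ha).1 (h a ha).le

/-- **RH iff no window form degenerates** (the sign-free reading): `RH ↔ ∀ a > 0, ε(a) ≠ 0`.
Under RH `ε > 0`; if RH fails, `ε` vanishes exactly on the onset window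
(`exists_isWeilOnset_of_not_riemannHypothesis`). [cite: Yoshida1992, Thm. 2 and Prop. 6] -/
theorem riemannHypothesis_iff_forall_weilGroundEnergy_ne_zero :
    RiemannHypothesis ↔ ∀ a : ℝ, 0 < a → weilGroundEnergy a ≠ 0 := by
  refine ⟨fun hRH a ha ↦ (weilGroundEnergy_pos_of_riemannHypothesis hRH ha).ne', fun h ↦ ?_⟩
  by_contra hRH
  obtain ⟨a₀, ha₀⟩ := exists_isWeilOnset_of_not_riemannHypothesis hRH
  exact h a₀ ha₀.pos ha₀.eq_zero

/-- Under RH the Weil form is coercive on every window: `Re Q(g) ≥ ε(a) ‖g‖₂²` with `ε(a) > 0`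
for every test `g` supported in `[-a, a]`. [cite: Yoshida1992, Thm. 2] -/
theorem weilQuadratic_re_ge_pos_mul_of_riemannHypothesis (hRH : RiemannHypothesis) {a : ℝ}
    (ha : 0 < a) :
    ∃ ε : ℝ, 0 < ε ∧ ∀ g : ℝ → ℂ, IsWeilTest g → tsupport g ⊆ Icc (-a) a →
      ε * (∫ t, ‖g t‖ ^ 2) ≤ (weilQuadratic g).re :=
  ⟨weilGroundEnergy a, weilGroundEnergy_pos_of_riemannHypothesis hRH ha,
    fun _ hg hsupp ↦ ConnesVanSuijlekom.weilGroundEnergy_mul_le_re hg hsupp⟩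

end Summit.RiemannHypothesis.RiemannHypothesis.Theorems

end
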